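import Summits.AtomisticToContinuum.FouriersLaw.Theorems.PhononMeanFreePathIncoherentBoundedGrowthDynkin
import Summits.AtomisticToContinuum.FouriersLaw.Theorems.PhononMeanFreePathIncoherentBoundedEnergyStatics
import Summits.AtomisticToContinuum.FouriersLaw.Theorems.PhononMeanFreePathIncoherentBoundedFixedN
import Summits.AtomisticToContinuum.FouriersLaw.Theorems.PhononMeanFreePathBoundaryKuboEnergyBalance

/-!
# `PhononMeanFreePath.IncoherentBounded` — Dynkin's identity and statics for the left block energies `E_{≤i}`

Helper file for item `stmt-AtomisticToContinuum-11815` (support `IncoherentBounded`, route `PhononMeanFreePath`,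
sub-problem `FouriersLaw`): the engine of the MIXED Kubo identities (file `…IncoherentBoundedMixedKubo`) which tie the
item's cross kinetic kernel `C_N` to the current–kinetic and current–current Green–Kubo integrals. For the pinned
anharmonic chain `pinnedChain ω₂ lam β γ` with `N + 1` sites, equal bath temperatures `T > 0`, the CONSTRUCTED kernels
`P_t = transitionKernel (N+1) T T t` and BLR's left block energies `E_{≤i} = HardTether.leftEnergy` (`L E_{≤i} = γ(T - p₀²) - j_i`
for a genuine bond `i`, `HardTether.bondCurrent_add_generator_leftEnergy`):

* `pinnedChain_generator_leftEnergy` — `L E_{≤i} = γ(T_L - p₀²) - j_i`;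
* `pinnedChain_leftEnergy_dynkin` — `P_r E_{≤i}(z) - E_{≤i}(z) = ∫₀ʳ P_s(γ(T - p₀²) - j_i)(z) ds` (bond `i < N`), by
  `pinnedChain_dynkin_of_growth` (`0 ≤ E_{≤i} ≤ H`, `∂_{p_k} E_{≤i} = [k ≤ i] p_k`);
* `integral_kinObs_mul_leftEnergy` — statics: `∫ (p_k² - T) E_{≤i} dμ_T = [k ≤ i] T²` for every size, block `i` and
  site `k` (Stein with the exponential weight): `= T²` at the near contact `k = 0`, `= 0` right of the block.

No definitions; nothing here closes an item.
-/

noncomputable section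

open MeasureTheory ProbabilityTheory Filter Topology Set
open scoped NNReal ENNReal
open Literature.MathematicalPhysics.KineticTheory.HeatConduction
open Literature.MathematicalPhysics.KineticTheory Literature.Probability.Process OscillatorChain
open Literature.MathematicalPhysics.KineticTheory.HeatConduction.HardTether
  (leftEnergy blockWeight bondWeight bondCurrent_add_generator_leftEnergy partialP_leftEnergy)
open Summit.AtomisticToContinuum.FouriersLaw.Theorems.SubdiffusiveBondHeat
open Summit.AtomisticToContinuum.FouriersLaw.Theorems.BoundaryKubo.GibbsTtcf
  (contDiff_leftEnergy leftEnergy_nonneg leftEnergy_le_hamiltonian blockWeight_nonneg_le_one)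

namespace Summit.AtomisticToContinuum.FouriersLaw.Theorems.IncoherentBounded

/-! ## 2. The left block energies: Dynkin and statics -/

section LeftEnergy

variable {ω₂ lam β γ : ℝ} (hω : 0 < ω₂) (hl : 0 ≤ lam) (hβ : 0 < β) (hγ : 0 < γ) {T : ℝ} (hT : 0 < T)
include hω hl hβ hγ hT

omit hT in
/-- `L E_{≤i} = γ(T_L - p₀²) - j_i` for the pinned chain with `N + 1` sites and a genuine bond `i < N`
(`HardTether.bondCurrent_add_generator_leftEnergy`). [cite: BonettoLebowitzReyBellet2000, §5.2 eqs. (24)–(26)] -/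
theorem pinnedChain_generator_leftEnergy {N : ℕ} {i : Fin (N + 1)} (hi : i.val + 1 < N + 1) (T_L T_R : ℝ)
    (x : PhaseSpace (N + 1)) :
    (pinnedChain ω₂ lam β γ).generator (N + 1) T_L T_R (leftEnergy (pinnedChain ω₂ lam β γ) (N + 1) i) x =
      γ * (T_L - x.2 0 ^ 2) - (pinnedChain ω₂ lam β γ).bondCurrent (N + 1) i x := by
  have hconf : (pinnedChain ω₂ lam β γ).IsConfining := pinnedChain_isConfining hω hl hβ.le hγ.le
  have e := bondCurrent_add_generator_leftEnergy (pinnedChain ω₂ lam β γ) hconf.differentiable_U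
    hconf.differentiable_V hi T_L T_R x
  have hsum : ∑ k : Fin (N + 1), (if k.val = 0 then (T_L - x.2 k ^ 2) else 0) = T_L - x.2 0 ^ 2 := by
    rw [Finset.sum_eq_single (0 : Fin (N + 1))]
    · simp
    · intro k _ hk
      rw [if_neg]
      intro h
      exact hk (Fin.ext h)
    · intro h; exact absurd (Finset.mem_univ _) h
  have hPγ : (pinnedChain ω₂ lam β γ).γ = γ := rfl
  rw [hsum, hPγ] at e
  linarith

/-- **Dynkin's identity for the left block energy `E_{≤i}`** of the pinned anharmonic chain (`N + 1` sites, genuine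
bond `i < N`, equal bath temperatures `T > 0`, constructed kernels):
`P_r E_{≤i}(z) - E_{≤i}(z) = ∫₀ʳ P_s(γ(T - p₀²) - j_i)(z) ds` for all `r ≥ 0`, `z`.
[cite: CuneoEckmannHairerReyBellet2018, §3 eq. (3.2)–(3.4)] -/
theorem pinnedChain_leftEnergy_dynkin {N : ℕ} {i : Fin (N + 1)} (hi : i.val + 1 < N + 1) (r : ℝ≥0)
    (z : PhaseSpace (N + 1)) :
    ∫ y, leftEnergy (pinnedChain ω₂ lam β γ) (N + 1) i y ∂((pinnedChain ω₂ lam β γ).transitionKernel (N + 1) T T r z) -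
        leftEnergy (pinnedChain ω₂ lam β γ) (N + 1) i z =
      ∫ s in (0 : ℝ)..(r : ℝ), ∫ y, (γ * (T - y.2 0 ^ 2) - (pinnedChain ω₂ lam β γ).bondCurrent (N + 1) i y)
        ∂((pinnedChain ω₂ lam β γ).transitionKernel (N + 1) T T s.toNNReal z) := by
  set P := pinnedChain ω₂ lam β γ with hP
  have hN : 0 < N + 1 := Nat.succ_pos N
  have hconf : P.IsConfining := pinnedChain_isConfining hω hl hβ.le hγ.le
  have hU0 := hconf.U_nonneg
  have hV0 := hconf.V_nonneg
  have hH0 : ∀ x, 0 ≤ P.hamiltonian (N + 1) x := hconf.hamiltonian_nonneg (N + 1)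
  have he : ContDiff ℝ 2 (leftEnergy P (N + 1) i) :=
    contDiff_leftEnergy P (pinnedChain_contDiff_U ω₂ lam β γ) (pinnedChain_contDiff_V ω₂ lam β γ) (N + 1) i
  -- derivative bounds at the bath sites: `∂_{p_k} E_{≤i} = [k ≤ i] p_k`
  have hdk : ∀ (k : Fin (N + 1)) (x : PhaseSpace (N + 1)), |partialP k (leftEnergy P (N + 1) i) x| ≤ |x.2 k| := by
    intro k x
    rw [partialP_leftEnergy P i k]
    simp only
    rw [abs_mul, abs_of_nonneg (blockWeight_nonneg_le_one i k).1]
    calc blockWeight i k * |x.2 k| ≤ 1 * |x.2 k| := mul_le_mul_of_nonneg_right (blockWeight_nonneg_le_one i k).2 (abs_nonneg _)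
      _ = |x.2 k| := one_mul _
  have ha : (⟨0, hN⟩ : Fin (N + 1)) = 0 := rfl
  -- the generator image and its size
  set ℓ : PhaseSpace (N + 1) → ℝ := fun y => γ * (T - y.2 0 ^ 2) - P.bondCurrent (N + 1) i y with hℓ
  have hgen : ∀ x, P.generator (N + 1) T T (leftEnergy P (N + 1) i) x = ℓ x := fun x =>
    pinnedChain_generator_leftEnergy hω hl hβ hγ hi T T x
  set B : ℝ := γ * (T + 1) + ((N + 1 : ℕ) : ℝ) * ((3 + β) / 2) with hB
  have hB0 : 0 ≤ B := by positivity
  have hℓb : ∀ y, |ℓ y| ≤ B * (1 + P.hamiltonian (N + 1) y) ^ 2 := fun y => by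
    have hj := pinnedChain_abs_bondCurrent_le hω.le hl hβ.le γ (N + 1) i y
    have hp : (y.2 0) ^ 2 ≤ 2 * P.hamiltonian (N + 1) y := by
      have hs := P.site_le_hamiltonian hU0 hV0 (N + 1) y 0
      linarith [hU0 (y.1 0)]
    have hHy := hH0 y
    rw [hℓ]
    dsimp only
    generalize P.hamiltonian (N + 1) y = Hy at hj hp hHy ⊢
    generalize P.bondCurrent (N + 1) i y = j at hj ⊢
    generalize y.2 0 = p at hp ⊢
    have h1 : |γ * (T - p ^ 2)| ≤ γ * (T + 1) * (1 + Hy) ^ 2 := by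
      rw [abs_mul, abs_of_pos hγ, mul_assoc]
      refine mul_le_mul_of_nonneg_left ?_ hγ.le
      have : |T - p ^ 2| ≤ T + p ^ 2 := by
        rw [abs_le]; constructor <;> nlinarith [sq_nonneg p]
      nlinarith [mul_nonneg hT.le hHy, mul_nonneg hT.le (sq_nonneg Hy), sq_nonneg Hy]
    calc |γ * (T - p ^ 2) - j| ≤ |γ * (T - p ^ 2)| + |j| := abs_sub _ _
      _ ≤ γ * (T + 1) * (1 + Hy) ^ 2 + ((N + 1 : ℕ) : ℝ) * ((3 + β) / 2 * (1 + Hy) ^ 2) := add_le_add h1 hj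
      _ = (γ * (T + 1) + ((N + 1 : ℕ) : ℝ) * ((3 + β) / 2)) * (1 + Hy) ^ 2 := by ring
  have h := pinnedChain_dynkin_of_growth hω hl hβ hγ hN hT he (leftEnergy_nonneg P hU0 hV0 (N + 1) i)
    (leftEnergy_le_hamiltonian P hU0 hV0 (N + 1) i) (hdk ⟨0, hN⟩) (hdk ⟨N + 1 - 1, Nat.sub_lt hN one_pos⟩)
    hgen hB0 hℓb r z
  exact h

omit hγ in
/-- **Statics of the left block energies**: `∫ (p_k² - T) E_{≤i} dμ_T = [k ≤ i] T²` for every chain size `n`, block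
`i` and site `k` (Stein with the exponential weight: `F = p_k E_{≤i}`, `∂_{p_k} F = E_{≤i} + [k ≤ i] p_k²`, and
equipartition). In particular `= T²` at the near contact `k = 0` and `= 0` at a site right of the block.
[folklore] -/
theorem integral_kinObs_mul_leftEnergy {n : ℕ} (i k : Fin n) :
    ∫ x, (x.2 k ^ 2 - T) * leftEnergy (pinnedChain ω₂ lam β γ) n i x ∂((pinnedChain ω₂ lam β γ).gibbsMeasure n T) =
      blockWeight i k * T ^ 2 := by
  set P := pinnedChain ω₂ lam β γ with hP
  set μ := P.gibbsMeasure n T with hμ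
  haveI : IsProbabilityMeasure μ := pinnedChain_isProbabilityMeasure_gibbsMeasure hω hl hβ.le γ n hT
  have hU0 : ∀ q, 0 ≤ P.U q := fun q => by
    show 0 ≤ ω₂ * q ^ 2 / 2 + lam * q ^ 4 / 4; positivity
  have hV0 : ∀ r, 0 ≤ P.V r := fun r => by
    show 0 ≤ r ^ 2 / 2 + β * r ^ 4 / 4; positivity
  set E : PhaseSpace n → ℝ := leftEnergy P n i with hE
  have hEc : Continuous E :=
    (contDiff_leftEnergy P (pinnedChain_contDiff_U ω₂ lam β γ) (pinnedChain_contDiff_V ω₂ lam β γ) n i (n := 0)).continuous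
  have hEd : Differentiable ℝ E :=
    (contDiff_leftEnergy P (pinnedChain_contDiff_U ω₂ lam β γ) (pinnedChain_contDiff_V ω₂ lam β γ) n i (n := 1)).differentiable
      one_ne_zero
  have hE0 : ∀ x, 0 ≤ E x := fun x => leftEnergy_nonneg P hU0 hV0 n i x
  have hEH : ∀ x, E x ≤ P.hamiltonian n x := fun x => leftEnergy_le_hamiltonian P hU0 hV0 n i x
  set w : ℝ := blockWeight i k with hw
  have hw01 := blockWeight_nonneg_le_one i k
  set ϑ : ℝ := 1 / (4 * T) with hϑ
  have hϑ0 : 0 < ϑ := by positivity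
  have hθ1 : 2 * ϑ < 1 / T := by
    rw [hϑ, show 2 * (1 / (4 * T)) = 1 / (2 * T) by field_simp; ring, div_lt_div_iff₀ (by positivity) hT]
    nlinarith
  have hϑ1 : ϑ < 1 / T := by linarith
  have hH0 : ∀ x, 0 ≤ P.hamiltonian n x := fun x => pinnedChain_hamiltonian_nonneg hω.le hl hβ.le γ n x
  have hHc : Continuous (P.hamiltonian n) := pinnedChain_continuous_hamiltonian ω₂ lam β γ n
  have hpc : Continuous fun x : PhaseSpace n => x.2 k := by fun_prop
  have hp1 : ∀ x, |x.2 k| ≤ (1 / 2 + 1 / ϑ) * Real.exp (ϑ * P.hamiltonian n x) := fun x =>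
    abs_momentum_le_exp hω hl hβ.le hϑ0 x k
  have hp2 : ∀ x, x.2 k ^ 2 ≤ (2 / ϑ) * Real.exp (ϑ * P.hamiltonian n x) := fun x =>
    sq_momentum_le_exp (γ := γ) hω hl hβ.le hϑ0 x k
  have hHe : ∀ x, P.hamiltonian n x ≤ Real.exp (ϑ * P.hamiltonian n x) / ϑ := fun x =>
    hamiltonian_le_exp (γ := γ) hϑ0 x
  have hEe : ∀ x, E x ≤ Real.exp (ϑ * P.hamiltonian n x) / ϑ := fun x => (hEH x).trans (hHe x)
  have hee : ∀ x, Real.exp (ϑ * P.hamiltonian n x) * Real.exp (ϑ * P.hamiltonian n x) =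
      Real.exp (2 * ϑ * P.hamiltonian n x) := fun x => by rw [← Real.exp_add]; ring_nf
  have he1 : ∀ x, Real.exp (ϑ * P.hamiltonian n x) ≤ Real.exp (2 * ϑ * P.hamiltonian n x) := fun x =>
    Real.exp_le_exp.2 (by nlinarith [hH0 x])
  set A : ℝ := (1 / 2 + 1 / ϑ) / ϑ + 3 / ϑ + 2 / ϑ ^ 2 with hA
  have hq1 : 0 ≤ (1 / 2 + 1 / ϑ) / ϑ := by positivity
  have hq2 : 0 ≤ 3 / ϑ := by positivity
  have hq3 : 0 ≤ 2 / ϑ ^ 2 := by positivity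
  have hA1 : (1 / 2 + 1 / ϑ) / ϑ ≤ A := by rw [hA]; linarith
  have hA2 : 3 / ϑ ≤ A := by rw [hA]; linarith
  have hA3 : 2 / ϑ ^ 2 ≤ A := by rw [hA]; linarith
  have hb1 : ∀ x, |x.2 k * E x| ≤ A * Real.exp (2 * ϑ * P.hamiltonian n x) := fun x => by
    rw [abs_mul, abs_of_nonneg (hE0 x)]
    calc |x.2 k| * E x
        ≤ ((1 / 2 + 1 / ϑ) * Real.exp (ϑ * P.hamiltonian n x)) * (Real.exp (ϑ * P.hamiltonian n x) / ϑ) :=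
          mul_le_mul (hp1 x) (hEe x) (hE0 x) (by positivity)
      _ = (1 / 2 + 1 / ϑ) / ϑ * Real.exp (2 * ϑ * P.hamiltonian n x) := by rw [← hee x]; ring
      _ ≤ A * Real.exp (2 * ϑ * P.hamiltonian n x) := mul_le_mul_of_nonneg_right hA1 (Real.exp_pos _).le
  have hb2 : ∀ x, |E x + x.2 k * (w * x.2 k)| ≤ A * Real.exp (2 * ϑ * P.hamiltonian n x) := fun x => by
    have hwp : 0 ≤ x.2 k * (w * x.2 k) := by
      rw [show x.2 k * (w * x.2 k) = w * x.2 k ^ 2 by ring]; exact mul_nonneg hw01.1 (sq_nonneg _)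
    have hwp' : x.2 k * (w * x.2 k) ≤ x.2 k ^ 2 := by
      rw [show x.2 k * (w * x.2 k) = w * x.2 k ^ 2 by ring]
      calc w * x.2 k ^ 2 ≤ 1 * x.2 k ^ 2 := mul_le_mul_of_nonneg_right hw01.2 (sq_nonneg _)
        _ = x.2 k ^ 2 := one_mul _
    rw [abs_of_nonneg (add_nonneg (hE0 x) hwp)]
    calc E x + x.2 k * (w * x.2 k) ≤ Real.exp (ϑ * P.hamiltonian n x) / ϑ + (2 / ϑ) * Real.exp (ϑ * P.hamiltonian n x) :=
          add_le_add (hEe x) (hwp'.trans (hp2 x))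
      _ = 3 / ϑ * Real.exp (ϑ * P.hamiltonian n x) := by ring
      _ ≤ A * Real.exp (2 * ϑ * P.hamiltonian n x) :=
          mul_le_mul hA2 (he1 x) (Real.exp_pos _).le (le_trans (by positivity) hA2)
  have hb3 : ∀ x, |x.2 k * (x.2 k * E x)| ≤ A * Real.exp (2 * ϑ * P.hamiltonian n x) := fun x => by
    rw [← mul_assoc, ← sq, abs_mul, abs_of_nonneg (sq_nonneg _), abs_of_nonneg (hE0 x)]
    calc x.2 k ^ 2 * E x
        ≤ ((2 / ϑ) * Real.exp (ϑ * P.hamiltonian n x)) * (Real.exp (ϑ * P.hamiltonian n x) / ϑ) :=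
          mul_le_mul (hp2 x) (hEe x) (hE0 x) (by positivity)
      _ = 2 / ϑ ^ 2 * Real.exp (2 * ϑ * P.hamiltonian n x) := by rw [← hee x]; ring
      _ ≤ A * Real.exp (2 * ϑ * P.hamiltonian n x) := mul_le_mul_of_nonneg_right hA3 (Real.exp_pos _).le
  -- the line derivative of `p_k E`
  have hline : ∀ x : PhaseSpace n, HasLineDerivAt ℝ (fun x : PhaseSpace n => x.2 k * E x)
      (E x + x.2 k * (w * x.2 k)) x ((0, Pi.single k 1) : PhaseSpace n) := by
    intro x
    have hEl : HasLineDerivAt ℝ E (w * x.2 k) x ((0, Pi.single k 1) : PhaseSpace n) := by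
      have h := hasLineDerivAt_partialP hEd k x
      rw [hE, partialP_leftEnergy P i k] at h
      exact h
    unfold HasLineDerivAt at hEl ⊢
    have h1 : HasDerivAt (fun t : ℝ => (x + t • ((0, Pi.single k 1) : PhaseSpace n)).2 k) 1 0 := by
      have key : (fun t : ℝ => (x + t • ((0, Pi.single k 1) : PhaseSpace n)).2 k) = fun t => x.2 k + t := by
        funext t; simp
      rw [key]
      exact (hasDerivAt_id (0 : ℝ)).const_add _
    have h := h1.mul hEl
    simp only [zero_smul, add_zero, one_mul] at h
    exact h
  have hS := stein_momentum_exp hω hl hβ.le hT k (F := fun x => x.2 k * E x)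
    (F' := fun x => E x + x.2 k * (w * x.2 k)) (hpc.mul hEc) (hEc.add (hpc.mul (continuous_const.mul hpc)))
    hline hθ1 hb1 hb2 hb3
  -- integrability under `μ_T`
  have hwμ : Integrable (fun x => Real.exp (2 * ϑ * P.hamiltonian n x)) μ :=
    pinnedChain_integrable_exp_mul_hamiltonian_gibbsMeasure hω hl hβ.le γ n hT hθ1
  have hIE : Integrable E μ := by
    refine integrable_of_abs_le_exp hwμ hEc (C := A) fun x => ?_
    rw [abs_of_nonneg (hE0 x)]
    calc E x ≤ Real.exp (ϑ * P.hamiltonian n x) / ϑ := hEe x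
      _ = 1 / ϑ * Real.exp (ϑ * P.hamiltonian n x) := by ring
      _ ≤ A * Real.exp (2 * ϑ * P.hamiltonian n x) :=
          mul_le_mul (le_trans (by rw [div_le_div_iff_of_pos_right hϑ0]; norm_num) hA2) (he1 x)
            (Real.exp_pos _).le (le_trans (by positivity) hA2)
  have hIp2 : Integrable (fun x : PhaseSpace n => x.2 k * (w * x.2 k)) μ := by
    refine integrable_of_abs_le_exp hwμ (hpc.mul (continuous_const.mul hpc)) (C := A) fun x => ?_
    rw [show x.2 k * (w * x.2 k) = w * x.2 k ^ 2 by ring, abs_mul, abs_of_nonneg hw01.1]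
    calc w * |x.2 k ^ 2| ≤ 1 * |x.2 k ^ 2| := mul_le_mul_of_nonneg_right hw01.2 (abs_nonneg _)
      _ = x.2 k ^ 2 := by rw [one_mul, abs_of_nonneg (sq_nonneg _)]
      _ ≤ (2 / ϑ) * Real.exp (ϑ * P.hamiltonian n x) := hp2 x
      _ ≤ A * Real.exp (2 * ϑ * P.hamiltonian n x) :=
          mul_le_mul (le_trans (by rw [div_le_div_iff_of_pos_right hϑ0]; norm_num) hA2) (he1 x)
            (Real.exp_pos _).le (le_trans (by positivity) hA2)
  have hIpE : Integrable (fun x : PhaseSpace n => x.2 k ^ 2 * E x) μ := by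
    refine integrable_of_abs_le_exp hwμ ((hpc.pow 2).mul hEc) (C := A) fun x => ?_
    have := hb3 x
    rwa [← mul_assoc, ← sq] at this
  -- equipartition `∫ p_k² dμ_T = T`, written as `∫ p_k (w p_k) = w T`
  have hT2 : ∫ x, x.2 k * (w * x.2 k) ∂μ = w * T := by
    have hϑ1' : 1 / (4 * T) < 1 / T := hϑ1
    have hi2 : Integrable (fun z : PhaseSpace n => z.2 k ^ 2) μ :=
      integrable_of_abs_le_exp (pinnedChain_integrable_exp_mul_hamiltonian_gibbsMeasure hω hl hβ.le γ n hT hϑ1')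
        (by fun_prop) (fun y => by rw [abs_of_nonneg (sq_nonneg _)]; exact hp2 y)
    have e : (fun x : PhaseSpace n => x.2 k * (w * x.2 k)) = fun x => w * x.2 k ^ 2 := by funext x; ring
    rw [e, integral_const_mul, integral_momentum_sq_gibbsMeasure hω hl hβ hT n k]
  -- assemble
  have e1 : ∫ x, (x.2 k ^ 2 - T) * E x ∂μ = (∫ x, x.2 k ^ 2 * E x ∂μ) - T * ∫ x, E x ∂μ := by
    have : (fun x : PhaseSpace n => (x.2 k ^ 2 - T) * E x) = fun x => x.2 k ^ 2 * E x - T * E x := funext fun x => by ring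
    rw [this, integral_sub hIpE (hIE.const_mul T), integral_const_mul]
  have e2 : ∫ x, x.2 k ^ 2 * E x ∂μ = ∫ x, x.2 k * (x.2 k * E x) ∂μ :=
    integral_congr_ae (Eventually.of_forall fun x => by simp only; ring)
  rw [e1, e2, hS, integral_add hIE hIp2, hT2]
  ring

end LeftEnergy

end Summit.AtomisticToContinuum.FouriersLaw.Theorems.IncoherentBounded

end
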